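import Summits.AtomisticToContinuum.Crystallization.Theorems.ChartedZeroExcessLayeredLatticeLiouvilleZZZYRB

/-!
# Charted zero-excess layered-lattice Liouville — ZZZYRCF: the two elementary lemmas behind line (D) TAIL-DEBIT (PROVED)

Cell `decomp-a2c`, lens 2, generation 99.  Line (D) (ZZZYRCD (274); pilot PASS, census l.9472) bounds the far part of the phonon Hessian pair by
pair and routes each far pair's radial deficit onto in-range pieces.  The two inequalities that carry it are typed and proved here, for provers
of (TL♯-D) `TailDebitP`:

* TL-1 `inner_forceConst_radial_lower` — THE RADIAL FLOOR of the Lennard–Jones pair Hessian beyond the well: for `‖w‖ ≥ 1`,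
  `⟪d, K(w)d⟫ ≥ −a₋(‖w‖)·⟪w,d⟫²/‖w‖²` with `a₋(r) = aMinus r := max 0 (7/r⁸ − 13/r¹⁴)` (= `(−V″(r))₊`; the transverse coefficient
  `V′(r)/r = r⁻⁸ − r⁻¹⁴` is non-negative there and is simply dropped).  `aMinus` vanishes on `r ≤ (13/7)^{1/6} ≈ 1.1087`, peaks `0.623` at
  `r = (13/4)^{1/6} ≈ 1.2171` and decreases beyond (memo NODE-g99 §2(a)).
* TL-IS `sq_inner_le_young_split` / `indexSplit_bound` — THE INDEX-SPLIT INEQUALITY (pure Euclidean algebra): for a unit chord direction `e`,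
  pieces `p_i ≠ 0` and piece differences `Δ_i` (`i < n`), any `α > 0` and any weight `A ≥ 0`,
  `A·⟪e, Σ_i Δ_i⟫² ≤ Σ_i [(1+α)·n·cos²θ_i·A]·⟪p_i,Δ_i⟫²/‖p_i‖² + Σ_i [(1+α⁻¹)·n·sin²θ_i·A]·‖Δ_i‖²`, `cos²θ_i = ⟪e,p_i⟫²/‖p_i‖²` — the two
  brackets are exactly the increments of the tables `θ_R`, `θ_N` of ZZZYRCD's `pairDebit` (memo §2(a) steps 2–3).

Theorem file, imports ZZZYRB (tree) only; 1 def (`aMinus`), 6 theorems, 0 sorry, no instance / notation / option. [g99]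
-/

open scoped BigOperators InnerProductSpace RealInnerProductSpace

namespace Summit.AtomisticToContinuum.Crystallization.Theorems.ChartedZeroExcessLayeredLatticeLiouville

open Summit.AtomisticToContinuum.Crystallization.Theorems.ChartedPlanarOrderRigidityDoor (E3)

/-! ### TL-1: the radial floor of the pair Hessian -/

/-- `a₋(r) := max 0 (7/r⁸ − 13/r¹⁴) = (−V″(r))₊` for the tree's Lennard–Jones normalisation (`V′(r)/r = r⁻⁸ − r⁻¹⁴`). [g99] -/
noncomputable def aMinus (r : ℝ) : ℝ := max 0 (7 / r ^ 8 - 13 / r ^ 14)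

/-- `a₋(r) ≥ 0`. [g99; docstring added in hand-2 g47 lane edition ed1] -/
theorem aMinus_nonneg (r : ℝ) : 0 ≤ aMinus r := le_max_left _ _

/-- ★ **TL-1 (PROVED)**: beyond the well (`‖w‖ ≥ 1`) the pair Hessian is bounded below by its radial deficit alone:
`−a₋(‖w‖)·⟪w,d⟫²/‖w‖² ≤ ⟪d, forceConst w d⟫`.  Proof: `⟪d,K(w)d⟫ = h‖d‖² + 2h′⟪w,d⟫²` with `h = t⁴ − t⁷ ≥ 0`, `2h′ = 14t⁸ − 8t⁵`,
`t = ‖w‖⁻² ≤ 1`; Cauchy–Schwarz `t⟪w,d⟫² ≤ ‖d‖²` turns `h‖d‖²` into `h·t⟪w,d⟫²`, and `h·t + 2h′ = 13t⁸ − 7t⁵ = −(7t⁴ − 13t⁷)·t`. [g99] -/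
theorem inner_forceConst_radial_lower (w d : E3) (hw : 1 ≤ ‖w‖) :
    -(aMinus ‖w‖ * (⟪w, d⟫ ^ 2 / ‖w‖ ^ 2)) ≤ ⟪d, forceConst w d⟫ := by
  have hq1 : 1 ≤ ‖w‖ ^ 2 := by nlinarith
  have hqpos : 0 < ‖w‖ ^ 2 := lt_of_lt_of_le one_pos hq1
  have hw0 : ‖w‖ ≠ 0 := by
    intro h; rw [h] at hw; norm_num at hw
  set t : ℝ := (‖w‖ ^ 2)⁻¹ with ht
  have ht0 : 0 < t := inv_pos.mpr hqpos
  have ht1 : t ≤ 1 := inv_le_one_of_one_le₀ hq1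
  have hform : ⟪d, forceConst w d⟫ = (-t ^ 7 + t ^ 4) * ‖d‖ ^ 2 + 2 * ⟪w, d⟫ * (7 * t ^ 8 - 4 * t ^ 5) * ⟪w, d⟫ := by
    rw [forceConst_apply, inner_add_right, real_inner_smul_right, real_inner_smul_right, real_inner_self_eq_norm_sq, real_inner_comm w d]
  have hCS : ⟪w, d⟫ ^ 2 ≤ ‖w‖ ^ 2 * ‖d‖ ^ 2 := by
    have h := abs_real_inner_le_norm w d
    calc ⟪w, d⟫ ^ 2 = |⟪w, d⟫| ^ 2 := (sq_abs _).symm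
      _ ≤ (‖w‖ * ‖d‖) ^ 2 := pow_le_pow_left₀ (abs_nonneg _) h 2
      _ = ‖w‖ ^ 2 * ‖d‖ ^ 2 := by ring
  have hCS' : t * ⟪w, d⟫ ^ 2 ≤ ‖d‖ ^ 2 := by
    have h1 : t * (‖w‖ ^ 2 * ‖d‖ ^ 2) = ‖d‖ ^ 2 := by rw [ht, ← mul_assoc, inv_mul_cancel₀ hqpos.ne', one_mul]
    calc t * ⟪w, d⟫ ^ 2 ≤ t * (‖w‖ ^ 2 * ‖d‖ ^ 2) := mul_le_mul_of_nonneg_left hCS ht0.le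
      _ = ‖d‖ ^ 2 := h1
  have hdiv : ⟪w, d⟫ ^ 2 / ‖w‖ ^ 2 = t * ⟪w, d⟫ ^ 2 := by rw [ht, div_eq_inv_mul]
  have hpow : 7 / ‖w‖ ^ 8 - 13 / ‖w‖ ^ 14 = 7 * t ^ 4 - 13 * t ^ 7 := by
    rw [ht]; field_simp
  have h47 : 0 ≤ t ^ 4 - t ^ 7 := by
    have : t ^ 7 ≤ t ^ 4 := pow_le_pow_of_le_one ht0.le ht1 (by norm_num)
    linarith
  have key : -((7 * t ^ 4 - 13 * t ^ 7) * (t * ⟪w, d⟫ ^ 2)) ≤ ⟪d, forceConst w d⟫ := by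
    rw [hform]
    nlinarith [mul_nonneg h47 (sub_nonneg.mpr hCS')]
  have hY : 0 ≤ t * ⟪w, d⟫ ^ 2 := by positivity
  have hmax : (7 * t ^ 4 - 13 * t ^ 7) * (t * ⟪w, d⟫ ^ 2) ≤ aMinus ‖w‖ * (t * ⟪w, d⟫ ^ 2) := by
    apply mul_le_mul_of_nonneg_right _ hY
    rw [aMinus, hpow]; exact le_max_right _ _
  rw [hdiv]; linarith

/-- TL-1, transverse part kept: for `‖w‖ ≥ 1` the full form is `⟪d,K(w)d⟫ ≥ −a₋(‖w‖)·⟪w,d⟫²/‖w‖² + 0·(‖d‖² − ⟪w,d⟫²/‖w‖²)`; stated as the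
corollary provers quote for a far pair `x` of a layered word: `−a₋·sqStretch-type term ≤` the pair energy.  (Restatement of the above with the
bond vector `e = bondVec a b w x`.) [g99] -/
theorem pairHess_radial_lower (a b : E3) (w : ℤ → E3) (φ : Cell 2 → ℤ → E3) (x : (Cell 2 × ℤ) × (Cell 2 × ℤ))
    (hx : 1 ≤ ‖bondVec a b w x‖) :
    -(aMinus ‖bondVec a b w x‖ * sqStretch a b w φ x) ≤
      ⟪φ x.2.1 x.2.2 - φ x.1.1 x.1.2, forceConst (bondVec a b w x) (φ x.2.1 x.2.2 - φ x.1.1 x.1.2)⟫ := by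
  unfold sqStretch
  exact inner_forceConst_radial_lower _ _ hx

/-! ### TL-IS: the index-split inequality -/

/-- Young + orthogonal split: for unit `e`, `u` and any `v`, `α > 0`:
`⟪e,v⟫² ≤ (1+α)·⟪e,u⟫²·⟪u,v⟫² + (1+α⁻¹)·(1 − ⟪e,u⟫²)·‖v‖²` (`e = ⟪e,u⟫u + w`, `‖w‖² = 1 − ⟪e,u⟫²`, Cauchy–Schwarz on `⟪w,v⟫`). [g99] -/
theorem sq_inner_le_young_split (e u v : E3) (he : ‖e‖ = 1) (hu : ‖u‖ = 1) {α : ℝ} (hα : 0 < α) :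
    ⟪e, v⟫ ^ 2 ≤ (1 + α) * ⟪e, u⟫ ^ 2 * ⟪u, v⟫ ^ 2 + (1 + α⁻¹) * (1 - ⟪e, u⟫ ^ 2) * ‖v‖ ^ 2 := by
  set c : ℝ := ⟪e, u⟫ with hc
  have hsplit : ⟪e, v⟫ = c * ⟪u, v⟫ + ⟪e - c • u, v⟫ := by
    rw [inner_sub_left, real_inner_smul_left]; ring
  have hn : ‖e - c • u‖ ^ 2 = 1 - c ^ 2 := by
    rw [norm_sub_sq_real, real_inner_smul_right, norm_smul, he, hu, Real.norm_eq_abs, mul_one, ← hc]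
    nlinarith [sq_abs c]
  have hb : ⟪e - c • u, v⟫ ^ 2 ≤ (1 - c ^ 2) * ‖v‖ ^ 2 := by
    have h := abs_real_inner_le_norm (e - c • u) v
    calc ⟪e - c • u, v⟫ ^ 2 = |⟪e - c • u, v⟫| ^ 2 := (sq_abs _).symm
      _ ≤ (‖e - c • u‖ * ‖v‖) ^ 2 := pow_le_pow_left₀ (abs_nonneg _) h 2
      _ = (1 - c ^ 2) * ‖v‖ ^ 2 := by rw [mul_pow, hn]
  set A : ℝ := c * ⟪u, v⟫ with hA
  set B : ℝ := ⟪e - c • u, v⟫ with hB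
  have hy : (A + B) ^ 2 ≤ (1 + α) * A ^ 2 + (1 + α⁻¹) * B ^ 2 := by
    have hid : (1 + α) * A ^ 2 + (1 + α⁻¹) * B ^ 2 - (A + B) ^ 2 = (α * A - B) ^ 2 / α := by
      field_simp; ring
    have hnn : 0 ≤ (α * A - B) ^ 2 / α := by positivity
    linarith
  have hα' : 0 ≤ 1 + α⁻¹ := by positivity
  calc ⟪e, v⟫ ^ 2 = (A + B) ^ 2 := by rw [hsplit]
    _ ≤ (1 + α) * A ^ 2 + (1 + α⁻¹) * B ^ 2 := hy
    _ ≤ (1 + α) * A ^ 2 + (1 + α⁻¹) * ((1 - c ^ 2) * ‖v‖ ^ 2) := by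
        have := mul_le_mul_of_nonneg_left hb hα'
        linarith
    _ = (1 + α) * ⟪e, u⟫ ^ 2 * ⟪u, v⟫ ^ 2 + (1 + α⁻¹) * (1 - ⟪e, u⟫ ^ 2) * ‖v‖ ^ 2 := by rw [hA, hc]; ring

/-- The same with a non-normalised piece `p ≠ 0` (`u = p/‖p‖`): `cos² = ⟪e,p⟫²/‖p‖²`, `⟪u,v⟫² = ⟪p,v⟫²/‖p‖²`. [g99] -/
theorem sq_inner_le_young_split' (e p v : E3) (he : ‖e‖ = 1) (hp : p ≠ 0) {α : ℝ} (hα : 0 < α) :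
    ⟪e, v⟫ ^ 2 ≤ (1 + α) * (⟪e, p⟫ ^ 2 / ‖p‖ ^ 2) * (⟪p, v⟫ ^ 2 / ‖p‖ ^ 2) +
      (1 + α⁻¹) * (1 - ⟪e, p⟫ ^ 2 / ‖p‖ ^ 2) * ‖v‖ ^ 2 := by
  have hp0 : ‖p‖ ≠ 0 := norm_ne_zero_iff.mpr hp
  have hu : ‖(‖p‖⁻¹ : ℝ) • p‖ = 1 := by rw [norm_smul, Real.norm_eq_abs, abs_inv, abs_norm, inv_mul_cancel₀ hp0]
  have h := sq_inner_le_young_split e ((‖p‖⁻¹ : ℝ) • p) v he hu hα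
  have e1 : ⟪e, (‖p‖⁻¹ : ℝ) • p⟫ ^ 2 = ⟪e, p⟫ ^ 2 / ‖p‖ ^ 2 := by
    rw [real_inner_smul_right]; field_simp
  have e2 : ⟪(‖p‖⁻¹ : ℝ) • p, v⟫ ^ 2 = ⟪p, v⟫ ^ 2 / ‖p‖ ^ 2 := by
    rw [real_inner_smul_left]; field_simp
  rw [e1, e2] at h
  exact h

/-- ★ **TL-IS (PROVED): the index-split bound.**  Unit chord direction `e`, pieces `p i ≠ 0`, piece differences `Δ i` (`i : Fin n`), `α > 0`,
weight `A ≥ 0` (for a far pair: `A = a₋(‖chord‖)`):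
`A·⟪e, Σ Δ i⟫² ≤ Σ_i [(1+α)·n·cos²θ_i·A]·(⟪p i, Δ i⟫²/‖p i‖²) + Σ_i [(1+α⁻¹)·n·(1 − cos²θ_i)·A]·‖Δ i‖²` — Cauchy–Schwarz over the `n` pieces,
then `sq_inner_le_young_split'` piece by piece.  The brackets are the `θ_R` / `θ_N` increments of memo NODE-g99 §2(a). [g99] -/
theorem indexSplit_bound {n : ℕ} (e : E3) (he : ‖e‖ = 1) (p Δ : Fin n → E3) (hp : ∀ i, p i ≠ 0) {α : ℝ} (hα : 0 < α)
    {A : ℝ} (hA : 0 ≤ A) :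
    A * ⟪e, ∑ i, Δ i⟫ ^ 2 ≤
      ∑ i, ((1 + α) * n * (⟪e, p i⟫ ^ 2 / ‖p i‖ ^ 2) * A) * (⟪p i, Δ i⟫ ^ 2 / ‖p i‖ ^ 2) +
        ∑ i, ((1 + α⁻¹) * n * (1 - ⟪e, p i⟫ ^ 2 / ‖p i‖ ^ 2) * A) * ‖Δ i‖ ^ 2 := by
  have hsum : ⟪e, ∑ i, Δ i⟫ = ∑ i, ⟪e, Δ i⟫ := inner_sum _ _ _
  have hcs : (∑ i, ⟪e, Δ i⟫) ^ 2 ≤ (n : ℝ) * ∑ i, ⟪e, Δ i⟫ ^ 2 := by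
    have h := sq_sum_le_card_mul_sum_sq (s := (Finset.univ : Finset (Fin n))) (f := fun i => ⟪e, Δ i⟫)
    simpa using h
  have hpiece : ∀ i, ⟪e, Δ i⟫ ^ 2 ≤ (1 + α) * (⟪e, p i⟫ ^ 2 / ‖p i‖ ^ 2) * (⟪p i, Δ i⟫ ^ 2 / ‖p i‖ ^ 2) +
      (1 + α⁻¹) * (1 - ⟪e, p i⟫ ^ 2 / ‖p i‖ ^ 2) * ‖Δ i‖ ^ 2 := fun i => sq_inner_le_young_split' e (p i) (Δ i) he (hp i) hα
  have hstep : ∑ i, ⟪e, Δ i⟫ ^ 2 ≤ ∑ i, ((1 + α) * (⟪e, p i⟫ ^ 2 / ‖p i‖ ^ 2) * (⟪p i, Δ i⟫ ^ 2 / ‖p i‖ ^ 2) +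
      (1 + α⁻¹) * (1 - ⟪e, p i⟫ ^ 2 / ‖p i‖ ^ 2) * ‖Δ i‖ ^ 2) := Finset.sum_le_sum fun i _ => hpiece i
  have hnA : 0 ≤ A * (n : ℝ) := by positivity
  calc A * ⟪e, ∑ i, Δ i⟫ ^ 2 = A * (∑ i, ⟪e, Δ i⟫) ^ 2 := by rw [hsum]
    _ ≤ A * ((n : ℝ) * ∑ i, ⟪e, Δ i⟫ ^ 2) := mul_le_mul_of_nonneg_left hcs hA
    _ = (A * n) * ∑ i, ⟪e, Δ i⟫ ^ 2 := by ring
    _ ≤ (A * n) * ∑ i, ((1 + α) * (⟪e, p i⟫ ^ 2 / ‖p i‖ ^ 2) * (⟪p i, Δ i⟫ ^ 2 / ‖p i‖ ^ 2) +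
          (1 + α⁻¹) * (1 - ⟪e, p i⟫ ^ 2 / ‖p i‖ ^ 2) * ‖Δ i‖ ^ 2) := mul_le_mul_of_nonneg_left hstep hnA
    _ = _ := by
        rw [Finset.mul_sum, ← Finset.sum_add_distrib]
        refine Finset.sum_congr rfl fun i _ => ?_
        ring

end Summit.AtomisticToContinuum.Crystallization.Theorems.ChartedZeroExcessLayeredLatticeLiouville
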